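import Summits.PneNP.PneNP.Theorems.LatticeMagicTaylorMinorantsBuySqrtKWeight

/-!
# Route LatticeMagic — `TaylorMinorantsBuySqrtK` (stmt-PneNP-2329): moments and Taylor sums

Helper file (2/3) for the proof of `Summit.PneNP.PneNP.Theses.LatticeMagic.TaylorMinorantsBuySqrtK`.
From the moment recursion of the weight file
(`moment_succ : (n+2i+4) m_{i+1} = (2i+1)‖w‖²r² m_i` for `m_i = ∫ ⟪w,x⟫^{2i} (r² − ‖x‖²)₊ dx`)
we derive, for the normalised Taylor moments `A_i = (2π)^{2i} m_i / (2i)!`,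

* the recursion `(n+2i+4)(2i+2) A_{i+1} = 4π²‖w‖²r² A_i` and, under `‖w‖²r² ≥ 4Kn`,
  `i + 1 ≤ K ≤ n`, the growth `A_{i+1} ≥ 2 A_i` (the true constant is `8π²/5`);
* the sign of alternating sums of such sequences (odd order `≤ −A_0`, even order `≥ A_0`);
* the evaluation `∫ T_M(2π⟪w,x⟫) (r² − ‖x‖²)₊ dx = Σ_{i≤M} (−1)^i A_i` of the weighted average of the
  order-`M` Taylor polynomial of `cos`, and the resulting PER-TERM BOUND `term_bound`:
  `c · Σ_{i≤M} (−1)^i A_i ≤ −|c| · ∫ (r² − ‖x‖²)₊` when the parity of `M` matches the sign of `c`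
  as in the route statement.
-/

open MeasureTheory
open scoped InnerProductSpace

namespace Summit.PneNP.PneNP.Theorems.TaylorMinorants

variable {n : ℕ}

/-- The weighted even moments are nonnegative. -/
theorem moment_nonneg (r : ℝ) (w : EuclideanSpace ℝ (Fin n)) (i : ℕ) :
    0 ≤ ∫ x : EuclideanSpace ℝ (Fin n), ⟪w, x⟫_ℝ ^ (2 * i) * max (r ^ 2 - ‖x‖ ^ 2) 0 := by
  apply integral_nonneg
  intro x
  have : 0 ≤ ⟪w, x⟫_ℝ ^ (2 * i) := by
    rw [pow_mul]
    exact pow_nonneg (sq_nonneg _) i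
  exact mul_nonneg this (le_max_right _ _)

/-- Recursion for the normalised Taylor moments `A i = (2π)^{2i}/(2i)! · m_i`:
`(n + 2i + 4)(2i + 2) · A (i+1) = 4π² ‖w‖² r² · A i`. -/
theorem taylorMoment_succ {r : ℝ} (hr : 0 ≤ r) (w : EuclideanSpace ℝ (Fin n)) (i : ℕ) :
    ((n : ℝ) + 2 * i + 4) * (2 * i + 2) *
        ((2 * Real.pi) ^ (2 * (i + 1)) / (Nat.factorial (2 * (i + 1)) : ℝ) *
          ∫ x : EuclideanSpace ℝ (Fin n), ⟪w, x⟫_ℝ ^ (2 * (i + 1)) * max (r ^ 2 - ‖x‖ ^ 2) 0)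
      = 4 * Real.pi ^ 2 * ‖w‖ ^ 2 * r ^ 2 *
        ((2 * Real.pi) ^ (2 * i) / (Nat.factorial (2 * i) : ℝ) *
          ∫ x : EuclideanSpace ℝ (Fin n), ⟪w, x⟫_ℝ ^ (2 * i) * max (r ^ 2 - ‖x‖ ^ 2) 0) := by
  have h := moment_succ hr w i
  set m1 := ∫ x : EuclideanSpace ℝ (Fin n), ⟪w, x⟫_ℝ ^ (2 * (i + 1)) * max (r ^ 2 - ‖x‖ ^ 2) 0
  set m0 := ∫ x : EuclideanSpace ℝ (Fin n), ⟪w, x⟫_ℝ ^ (2 * i) * max (r ^ 2 - ‖x‖ ^ 2) 0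
  have hf : (Nat.factorial (2 * (i + 1)) : ℝ)
      = (Nat.factorial (2 * i) : ℝ) * (2 * i + 1) * (2 * i + 2) := by
    rw [show 2 * (i + 1) = (2 * i + 1) + 1 by ring, Nat.factorial_succ, Nat.factorial_succ]
    push_cast
    ring
  have hfpos : (0 : ℝ) < (Nat.factorial (2 * i) : ℝ) := by positivity
  have h1 : (0 : ℝ) < 2 * i + 1 := by positivity
  have h2 : (0 : ℝ) < 2 * i + 2 := by positivity
  rw [hf, show 2 * (i + 1) = 2 * i + 2 by ring, pow_add]
  calc ((n : ℝ) + 2 * i + 4) * (2 * i + 2) *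
        ((2 * Real.pi) ^ (2 * i) * (2 * Real.pi) ^ 2 /
          ((Nat.factorial (2 * i) : ℝ) * (2 * i + 1) * (2 * i + 2)) * m1)
      = (2 * Real.pi) ^ (2 * i) * (2 * Real.pi) ^ 2 / ((Nat.factorial (2 * i) : ℝ) * (2 * i + 1))
          * (((n : ℝ) + 2 * i + 4) * m1) := by
        field_simp
    _ = (2 * Real.pi) ^ (2 * i) * (2 * Real.pi) ^ 2 / ((Nat.factorial (2 * i) : ℝ) * (2 * i + 1))
          * ((2 * i + 1) * ‖w‖ ^ 2 * r ^ 2 * m0) := by rw [h]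
    _ = 4 * Real.pi ^ 2 * ‖w‖ ^ 2 * r ^ 2 *
          ((2 * Real.pi) ^ (2 * i) / (Nat.factorial (2 * i) : ℝ) * m0) := by
        field_simp
        ring

/-- Growth from the recursion: if `(n+2i+4)(2i+2) A(i+1) = 4π² C A(i)` with `C ≥ 4Kn`,
`i + 1 ≤ K ≤ n` and `A ≥ 0`, then `A (i+1) ≥ 2 A i` (indeed `≥ 14 A i`). -/
theorem two_mul_le_of_recursion {K i : ℕ} {C a₀ a₁ : ℝ} (ha₀ : 0 ≤ a₀) (ha₁ : 0 ≤ a₁)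
    (hrec : ((n : ℝ) + 2 * i + 4) * (2 * i + 2) * a₁ = 4 * Real.pi ^ 2 * C * a₀)
    (hi : i + 1 ≤ K) (hK : K ≤ n) (hC : 4 * (K : ℝ) * n ≤ C) : 2 * a₀ ≤ a₁ := by
  have hpi : (3 : ℝ) < Real.pi := Real.pi_gt_three
  have hn1 : (1 : ℝ) ≤ n := by exact_mod_cast (show 1 ≤ n by omega)
  have hK1 : (1 : ℝ) ≤ K := by exact_mod_cast (show 1 ≤ K by omega)
  have hiK : (i : ℝ) + 1 ≤ K := by exact_mod_cast hi
  have hKn : (K : ℝ) ≤ n := by exact_mod_cast hK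
  have e1 : ((n : ℝ) + 2 * i + 4) * (2 * i + 2) ≤ 10 * n * K := by nlinarith
  have e2 : ((n : ℝ) + 2 * i + 4) * (2 * i + 2) * a₁ ≤ 10 * n * K * a₁ :=
    mul_le_mul_of_nonneg_right e1 ha₁
  have e3 : 4 * (3 : ℝ) ^ 2 * (4 * K * n) * a₀ ≤ 4 * Real.pi ^ 2 * C * a₀ := by
    apply mul_le_mul_of_nonneg_right _ ha₀
    have h9 : (3 : ℝ) ^ 2 ≤ Real.pi ^ 2 := by nlinarith
    have f1 : (3 : ℝ) ^ 2 * (4 * K * n) ≤ 3 ^ 2 * C := mul_le_mul_of_nonneg_left hC (by norm_num)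
    have f2 : (3 : ℝ) ^ 2 * C ≤ Real.pi ^ 2 * C := by
      apply mul_le_mul_of_nonneg_right h9
      have : (0 : ℝ) ≤ 4 * K * n := by positivity
      linarith
    linarith
  have hnK : (0 : ℝ) < n * K := by positivity
  nlinarith

/-- Alternating sums of a sequence that is nondecreasing on `[0, M]` and at least doubles at the
first step: parity decides the sign (auxiliary induction). -/
theorem alternating_sum_aux (A : ℕ → ℝ) (M : ℕ) (h1 : 1 ≤ M → 2 * A 0 ≤ A 1)
    (hmono : ∀ i, i + 1 ≤ M → A i ≤ A (i + 1)) (l : ℕ) :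
    (2 * l + 1 ≤ M → ∑ i ∈ Finset.range (2 * l + 2), (-1 : ℝ) ^ i * A i ≤ -A 0) ∧
    (2 * l ≤ M → A 0 ≤ ∑ i ∈ Finset.range (2 * l + 1), (-1 : ℝ) ^ i * A i) := by
  induction l with
  | zero =>
    constructor
    · intro hM
      have := h1 (by omega)
      simp [Finset.sum_range_succ]
      linarith
    · intro _
      simp
  | succ l ih =>
    obtain ⟨ih1, ih2⟩ := ih
    constructor
    · intro hM
      have hprev := ih1 (by omega)
      have hm := hmono (2 * l + 2) (by omega)
      rw [show 2 * (l + 1) + 2 = (2 * l + 2) + 1 + 1 by ring, Finset.sum_range_succ,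
        Finset.sum_range_succ]
      have hs1 : (-1 : ℝ) ^ (2 * l + 2) = 1 := by
        rw [show 2 * l + 2 = 2 * (l + 1) by ring]; exact Even.neg_one_pow ⟨l + 1, by ring⟩
      have hs2 : (-1 : ℝ) ^ (2 * l + 2 + 1) = -1 := by
        rw [pow_succ, hs1]; ring
      rw [hs1, hs2]
      linarith
    · intro hM
      have hprev := ih2 (by omega)
      have hm := hmono (2 * l + 1) (by omega)
      rw [show 2 * (l + 1) + 1 = (2 * l + 1) + 1 + 1 by ring, Finset.sum_range_succ,
        Finset.sum_range_succ]
      have hs1 : (-1 : ℝ) ^ (2 * l + 1) = -1 := Odd.neg_one_pow ⟨l, by ring⟩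
      have hs2 : (-1 : ℝ) ^ (2 * l + 1 + 1) = 1 := by
        rw [pow_succ, hs1]; ring
      rw [hs1, hs2]
      linarith

/-- Odd order: the alternating sum is `≤ -A 0`. -/
theorem alternating_sum_odd (A : ℕ → ℝ) {M : ℕ} (hM : Odd M) (h1 : 1 ≤ M → 2 * A 0 ≤ A 1)
    (hmono : ∀ i, i + 1 ≤ M → A i ≤ A (i + 1)) :
    ∑ i ∈ Finset.range (M + 1), (-1 : ℝ) ^ i * A i ≤ -A 0 := by
  obtain ⟨l, rfl⟩ := hM
  have := (alternating_sum_aux A (2 * l + 1) h1 hmono l).1 le_rfl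
  simpa using this

/-- Even order: the alternating sum is `≥ A 0`. -/
theorem alternating_sum_even (A : ℕ → ℝ) {M : ℕ} (hM : Even M) (h1 : 1 ≤ M → 2 * A 0 ≤ A 1)
    (hmono : ∀ i, i + 1 ≤ M → A i ≤ A (i + 1)) :
    A 0 ≤ ∑ i ∈ Finset.range (M + 1), (-1 : ℝ) ^ i * A i := by
  obtain ⟨l, rfl⟩ := hM
  have := (alternating_sum_aux A (l + l) h1 hmono l).2 (by omega)
  rw [show 2 * l = l + l by ring] at this
  exact this

/-- The Taylor polynomial `Σ_{i ≤ M} (−1)^i (2π⟪w,x⟫)^{2i}/(2i)!` is continuous in `x`. -/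
theorem continuous_taylorPoly (M : ℕ) (w : EuclideanSpace ℝ (Fin n)) :
    Continuous fun x : EuclideanSpace ℝ (Fin n) => ∑ i ∈ Finset.range (M + 1),
      (-1 : ℝ) ^ i * (2 * Real.pi * ⟪w, x⟫_ℝ) ^ (2 * i) / (Nat.factorial (2 * i) : ℝ) := by
  fun_prop

/-- At `w = 0` the Taylor polynomial is identically `1`. -/
theorem taylorPoly_zero (M : ℕ) (x : EuclideanSpace ℝ (Fin n)) :
    ∑ i ∈ Finset.range (M + 1), (-1 : ℝ) ^ i *
      (2 * Real.pi * ⟪(0 : EuclideanSpace ℝ (Fin n)), x⟫_ℝ) ^ (2 * i) / (Nat.factorial (2 * i) : ℝ)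
      = 1 := by
  rw [Finset.sum_eq_single 0]
  · simp
  · intro i _ hi
    rw [inner_zero_left, mul_zero, zero_pow (by omega)]
    simp
  · intro h
    simp at h

/-- Integrating the Taylor polynomial against the weight gives the alternating sum of the
normalised moments. -/
theorem integral_taylorPoly_mul_wt {r : ℝ} (hr : 0 ≤ r) (M : ℕ) (w : EuclideanSpace ℝ (Fin n)) :
    ∫ x : EuclideanSpace ℝ (Fin n), (∑ i ∈ Finset.range (M + 1),
        (-1 : ℝ) ^ i * (2 * Real.pi * ⟪w, x⟫_ℝ) ^ (2 * i) / (Nat.factorial (2 * i) : ℝ))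
        * max (r ^ 2 - ‖x‖ ^ 2) 0
      = ∑ i ∈ Finset.range (M + 1), (-1 : ℝ) ^ i *
        ((2 * Real.pi) ^ (2 * i) / (Nat.factorial (2 * i) : ℝ) *
          ∫ x : EuclideanSpace ℝ (Fin n), ⟪w, x⟫_ℝ ^ (2 * i) * max (r ^ 2 - ‖x‖ ^ 2) 0) := by
  have hI : ∀ i : ℕ, Integrable (fun x : EuclideanSpace ℝ (Fin n) =>
      ⟪w, x⟫_ℝ ^ (2 * i) * max (r ^ 2 - ‖x‖ ^ 2) 0) := fun i => integrable_mul_wt hr (by fun_prop)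
  have hpt : ∀ x : EuclideanSpace ℝ (Fin n), (∑ i ∈ Finset.range (M + 1),
        (-1 : ℝ) ^ i * (2 * Real.pi * ⟪w, x⟫_ℝ) ^ (2 * i) / (Nat.factorial (2 * i) : ℝ))
        * max (r ^ 2 - ‖x‖ ^ 2) 0
      = ∑ i ∈ Finset.range (M + 1),
          ((-1 : ℝ) ^ i * (2 * Real.pi) ^ (2 * i) / (Nat.factorial (2 * i) : ℝ))
            * (⟪w, x⟫_ℝ ^ (2 * i) * max (r ^ 2 - ‖x‖ ^ 2) 0) := by
    intro x
    rw [Finset.sum_mul]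
    refine Finset.sum_congr rfl ?_
    intro i _
    rw [mul_pow]
    ring
  simp_rw [hpt]
  rw [integral_finsetSum _ (fun i _ => (hI i).const_mul _)]
  refine Finset.sum_congr rfl ?_
  intro i _
  rw [integral_const_mul]
  ring

/-- From the norm hypothesis of the route statement to `4 K n ≤ ‖w‖² r²`. -/
theorem four_mul_le_of_hyp {r : ℝ} (hr : 0 < r) {K : ℕ} {w : EuclideanSpace ℝ (Fin n)}
    (hw : 2 * Real.sqrt ((K : ℝ) * n) / r ≤ ‖w‖) : 4 * (K : ℝ) * n ≤ ‖w‖ ^ 2 * r ^ 2 := by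
  rw [div_le_iff₀ hr] at hw
  have h0 : 0 ≤ 2 * Real.sqrt ((K : ℝ) * n) := by positivity
  have h1 := pow_le_pow_left₀ h0 hw 2
  rw [mul_pow, Real.sq_sqrt (by positivity)] at h1
  nlinarith [h1]

/-- **Per-term bound.** For a dual vector `w` with `‖w‖ ≥ 2√(Kn)/r`, an order `M ≤ K ≤ n` of the
parity dictated by the sign of the weight `c`, the weighted average of `c · T_M(2π⟪w,·⟫)` is at
most `−|c| · ∫ (r² − ‖x‖²)₊`. -/
theorem term_bound {r : ℝ} (hr : 0 < r) {K M : ℕ} (hKn : K ≤ n) (hM : M ≤ K) (c : ℝ)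
    (w : EuclideanSpace ℝ (Fin n)) (hodd : 0 ≤ c → Odd M) (heven : c < 0 → Even M)
    (hw : 2 * Real.sqrt ((K : ℝ) * n) / r ≤ ‖w‖) :
    c * ∑ i ∈ Finset.range (M + 1), (-1 : ℝ) ^ i *
        ((2 * Real.pi) ^ (2 * i) / (Nat.factorial (2 * i) : ℝ) *
          ∫ x : EuclideanSpace ℝ (Fin n), ⟪w, x⟫_ℝ ^ (2 * i) * max (r ^ 2 - ‖x‖ ^ 2) 0)
      ≤ -|c| * ∫ x : EuclideanSpace ℝ (Fin n), max (r ^ 2 - ‖x‖ ^ 2) 0 := by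
  set A : ℕ → ℝ := fun i => (2 * Real.pi) ^ (2 * i) / (Nat.factorial (2 * i) : ℝ) *
    ∫ x : EuclideanSpace ℝ (Fin n), ⟪w, x⟫_ℝ ^ (2 * i) * max (r ^ 2 - ‖x‖ ^ 2) 0 with hA
  have hw' := four_mul_le_of_hyp hr hw
  have hApos : ∀ i, 0 ≤ A i := by
    intro i
    simp only [hA]
    exact mul_nonneg (by positivity) (moment_nonneg r w i)
  have hgrow : ∀ i, i + 1 ≤ K → 2 * A i ≤ A (i + 1) := by
    intro i hi
    have h := taylorMoment_succ hr.le w i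
    refine two_mul_le_of_recursion (C := ‖w‖ ^ 2 * r ^ 2) (hApos i) (hApos (i + 1)) ?_ hi hKn hw'
    simp only [hA]
    rw [h]
    ring
  have hmono : ∀ i, i + 1 ≤ M → A i ≤ A (i + 1) := by
    intro i hi
    have := hgrow i (by omega)
    have := hApos i
    linarith
  have h1 : 1 ≤ M → 2 * A 0 ≤ A 1 := fun hM1 => hgrow 0 (by omega)
  have hA0 : A 0 = ∫ x : EuclideanSpace ℝ (Fin n), max (r ^ 2 - ‖x‖ ^ 2) 0 := by
    simp [hA]
  rw [← hA0]
  rcases le_or_gt 0 c with hc | hc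
  · have hS := alternating_sum_odd A (hodd hc) h1 hmono
    rw [abs_of_nonneg hc]
    have := mul_le_mul_of_nonneg_left hS hc
    linarith
  · have hS := alternating_sum_even A (heven hc) h1 hmono
    rw [abs_of_neg hc]
    have := mul_le_mul_of_nonpos_left hS hc.le
    linarith

end Summit.PneNP.PneNP.Theorems.TaylorMinorants
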